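import Mathlib.Algebra.BigOperators.Field
import Literature.Analysis.FluidPDE.FiniteFourierModeEulerPlanarPolyA

/-!
# Kishimoto–Yoneda §3 (planar case): the boundary polygon, II — sectors, gauge, vertices

Support file for `FiniteFourierModeEuler` (N. Kishimoto, T. Yoneda, J. Math. Fluid Mech. 24
(2022) 74 = arXiv:2110.08039), §3, continuing `FiniteFourierModeEulerPlanarPolyA`: the sector
decomposition of the plane by the vertex rays (`exists_sector`: "`ñ = q{(1-θ)n_j + θn_{j+1}}` … in
a unique way"), injectivity of the vertex enumeration, the strict inequalities `f_j < 1` at the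
other vertices, the vertex-exposing functionals `g_j` ("`g(n₀) = 1` and `g < 1` on
`S^{conv}_∥ ∖ {n₀}`"), and the Minkowski functional `N = max_j f_j` ("`N ≡ f` on the sectorial
region", subadditivity).

## References

* [KishimotoYoneda2022] N. Kishimoto, T. Yoneda, J. Math. Fluid Mech. 24 (2022) 74 =
  arXiv:2110.08039, §3 proofs of Prop. 3.1, Lemma 3.2, Lemma 3.3 (the functionals `f`, `g`, `N`).
* [folklore] planar convex polygons.
-/

noncomputable section

open Matrix Finset Complex

namespace Literature.Analysis.FluidPDE

namespace KY

open scoped Classical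

namespace PolyCfg

variable {T : Finset (Fin 3 → ℝ)} {e : Fin 3 → ℝ} (P : PolyCfg T e)
include P

/-! ### The sector decomposition of the plane -/

omit P in
/-- A cyclic sign change: a real sequence of period `p > 0` taking a non-positive and a positive
value has consecutive indices `j, j+1` with `a j ≤ 0 < a (j+1)`. [folklore] -/
theorem exists_cyclic_switch {p : ℕ} (hp : 0 < p) (a : ℕ → ℝ) (hper : ∀ j, a (j + p) = a j)
    {i₀ i₁ : ℕ} (h₀ : a i₀ ≤ 0) (h₁ : 0 < a i₁) : ∃ j, a j ≤ 0 ∧ 0 < a (j + 1) := by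
  by_contra hno
  push Not at hno
  -- from `i₀` on, everything is `≤ 0`
  have hall : ∀ k, a (i₀ + k) ≤ 0 := by
    intro k
    induction k with
    | zero => simpa using h₀
    | succ k ih => rw [← add_assoc]; exact hno _ ih
  have hper' : ∀ k j, a (j + k * p) = a j := by
    intro k
    induction k with
    | zero => simp
    | succ k ih => intro j; rw [Nat.succ_mul, ← add_assoc, hper, ih]
  have : a i₁ ≤ 0 := by
    have h' := hall (i₁ + i₀ * p - i₀)
    have hle : i₀ ≤ i₀ * p := Nat.le_mul_of_pos_right i₀ hp
    have hidx : i₀ + (i₁ + i₀ * p - i₀) = i₁ + i₀ * p := by omega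
    rw [hidx, hper' i₀ i₁] at h'
    exact h'
  linarith

/-- A linear functional `⊥ e` which is non-negative (resp. positive) at all vertices is so on `T`
(`T ⊆ conv{V_j}`). [folklore] -/
theorem dot_nonneg_of_vertices {w : Fin 3 → ℝ} (hw : w ⬝ᵥ e = 0) (hpos : ∀ j, j ≤ P.m → 0 ≤ w ⬝ᵥ P.V j)
    {s : Fin 3 → ℝ} (hs : s ∈ T) : 0 ≤ w ⬝ᵥ s := by
  have hsL : s + hc e • e ∈ face (lift T e) e 1 :=
    Finset.mem_filter.2 ⟨add_mem_lift.2 hs, P.lift_level (add_mem_lift.2 hs)⟩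
  have hmem := FaceCfg.face_subset_convexHull (p₀ := P.p₀) (Finset.mem_coe.2 hsL)
  -- every generator is a lifted vertex
  have hgen : ∀ y ∈ insert P.p₀ ((verts (lift T e) e P.p₀ 1 : Finset (Fin 3 → ℝ)) : Set (Fin 3 → ℝ)),
      (-w) ⬝ᵥ y ≤ 0 := by
    intro y hy
    rw [neg_dotProduct, neg_nonpos]
    have hwe : ∀ j, w ⬝ᵥ chain (lift T e) e P.p₀ j = w ⬝ᵥ P.V j := by
      intro j; rw [← P.V_add_lift, dotProduct_add, dotProduct_smul, hw, smul_zero, add_zero]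
    rcases hy with rfl | hy
    · have := hpos 0 (Nat.zero_le _)
      rwa [← hwe 0, chain_of_le (Nat.zero_le _), FaceCfg.poly_zero] at this
    · rw [Finset.mem_coe] at hy
      obtain ⟨i, hi⟩ := FaceCfg.exists_keyOf_eq hy
      have hsp := (FaceCfg.poly_spec (S := lift T e) (φ := e) (p₀ := P.p₀) (M := 1) (j := i.1 + 1)
        (by omega) (by have := i.2; omega))
      have heq : FaceCfg.poly (lift T e) e P.p₀ 1 (i.1 + 1) = y := by
        apply P.faceCfg.slope_injOn (Finset.mem_coe.2 hsp.1) (Finset.mem_coe.2 hy)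
        rw [hsp.2, ← hi]
        congr 1
      have := hpos (i.1 + 1) (by have := i.2; show _ ≤ FaceCfg.nverts _ _ _ _; omega)
      rwa [← hwe, chain_of_le (by have := i.2; omega), heq] at this
  have := dot_le_of_mem_convexHull hgen hmem
  rw [neg_dotProduct, neg_nonpos, dotProduct_add, dotProduct_smul, hw, smul_zero, add_zero] at this
  exact this

omit P in
/-- The linear functional `y ↦ τ(x, y)` is the dot product with `e × x`. [folklore] -/
theorem pc_eq_dot_cross (x y : Fin 3 → ℝ) : pc e x y = (e ⨯₃ x) ⬝ᵥ y := pc_eq_cross_dot e x y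

/-- **Sector decomposition of the plane**: every non-zero planar vector lies in a sector
`{s V_j + t V_{j+1} : s > 0, t ≥ 0}`. [cite: KishimotoYoneda2022, §3 proof of Lemma 3.2 ("`ñ = q{(1-θ)n_j + θ n_{j+1}}` … in a unique way")] -/
theorem exists_sector {x : Fin 3 → ℝ} (hx : e ⬝ᵥ x = 0) (hx0 : x ≠ 0) :
    ∃ j, j < P.m + 1 ∧ ∃ s t : ℝ, 0 < s ∧ 0 ≤ t ∧ x = s • P.V j + t • P.V (j + 1) := by
  set a : ℕ → ℝ := fun k => pc e x (P.V k) with ha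
  have hper : ∀ k, a (k + (P.m + 1)) = a k := fun k => by simp only [ha, P.V_periodic]
  have hwe : (e ⨯₃ x) ⬝ᵥ e = 0 := by rw [dotProduct_comm, dot_self_cross]
  -- not all `a k > 0`, and not all `a k ≤ 0`
  have h₀ : ∃ i₀, a i₀ ≤ 0 := by
    by_contra hno
    push Not at hno
    have hall := P.dot_nonneg_of_vertices hwe (fun j _ => by rw [← pc_eq_dot_cross]; exact (hno j).le)
      (P.symm _ (P.V_mem 0))
    rw [← pc_eq_dot_cross, pc_neg_right] at hall
    linarith [hno 0]
  have h₁ : ∃ i₁, 0 < a i₁ := by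
    by_contra hno
    push Not at hno
    -- then `τ(x, s) = 0` on `T`, so `T ∥ x`: contradiction with spanning
    have hz : ∀ s ∈ T, pc e x s = 0 := by
      intro s hs
      have h1 := P.dot_nonneg_of_vertices (w := -(e ⨯₃ x)) (by rw [neg_dotProduct, hwe, neg_zero])
        (fun j _ => by rw [neg_dotProduct, ← pc_eq_dot_cross, neg_nonneg]; exact hno j) hs
      have h2 := P.dot_nonneg_of_vertices (w := -(e ⨯₃ x)) (by rw [neg_dotProduct, hwe, neg_zero])
        (fun j _ => by rw [neg_dotProduct, ← pc_eq_dot_cross, neg_nonneg]; exact hno j) (P.symm s hs)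
      rw [neg_dotProduct, ← pc_eq_dot_cross] at h1 h2
      rw [pc_neg_right] at h2
      linarith
    obtain ⟨p, hp, q, hq, hpq⟩ := P.span
    have hxp : x ⨯₃ p = 0 := by
      rw [cross_planar P.he hx (P.plane p hp), hz p hp, zero_div, zero_smul]
    have hxq : x ⨯₃ q = 0 := by
      rw [cross_planar P.he hx (P.plane q hq), hz q hq, zero_div, zero_smul]
    have ep := eq_smul_of_cross_eq_zero hx0 (u := p) (by rw [← cross_anticomm, hxp, neg_zero])
    have eq' := eq_smul_of_cross_eq_zero hx0 (u := q) (by rw [← cross_anticomm, hxq, neg_zero])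
    apply hpq
    rw [ep, eq', pc_smul_left, pc_smul_right, pc_self, mul_zero, mul_zero]
  obtain ⟨i₀, hi₀⟩ := h₀
  obtain ⟨i₁, hi₁⟩ := h₁
  obtain ⟨j, hj0, hj1⟩ := exists_cyclic_switch (Nat.succ_pos _) a hper hi₀ hi₁
  -- reduce `j` modulo the period
  refine ⟨j % (P.m + 1), Nat.mod_lt _ (Nat.succ_pos _), a (j + 1) / pc e (P.V j) (P.V (j + 1)),
    -a j / pc e (P.V j) (P.V (j + 1)), div_pos hj1 (P.tau_pos j),
    div_nonneg (by linarith) (P.tau_pos j).le, ?_⟩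
  have hVj : P.V (j % (P.m + 1)) = P.V j := by
    conv_rhs => rw [← Nat.mod_add_div j (P.m + 1)]
    clear hj0 hj1
    induction j / (P.m + 1) with
    | zero => simp
    | succ k ih => rw [Nat.mul_succ, ← add_assoc, P.V_periodic, ih]
  have hVj1 : P.V (j % (P.m + 1) + 1) = P.V (j + 1) := by
    conv_rhs => rw [← Nat.mod_add_div j (P.m + 1), add_right_comm]
    clear hj0 hj1 hVj
    induction j / (P.m + 1) with
    | zero => simp
    | succ k ih => rw [Nat.mul_succ, ← add_assoc, P.V_periodic, ih]
  rw [hVj, hVj1]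
  have hcr := P.cramer_planar hx (P.V_plane j) (P.V_plane (j + 1))
  have hτ := (P.tau_pos j).ne'
  apply smul_right_injective (Fin 3 → ℝ) hτ
  dsimp only
  rw [hcr, smul_add, smul_smul, smul_smul, mul_div_cancel₀ _ hτ, mul_div_cancel₀ _ hτ]
  simp only [ha]
  rw [pc_anticomm e x (P.V j)]

/-! ### Vertices versus edge functionals -/

/-- `poly` is injective on `0, …, m`. [folklore] -/
theorem poly_injective {i j : ℕ} (hi : i ≤ P.m) (hj : j ≤ P.m)
    (h : FaceCfg.poly (lift T e) e P.p₀ 1 i = FaceCfg.poly (lift T e) e P.p₀ 1 j) : i = j := by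
  unfold m at hi hj
  rcases Nat.eq_zero_or_pos i with rfl | hi0 <;> rcases Nat.eq_zero_or_pos j with rfl | hj0
  · rfl
  · exfalso
    rw [FaceCfg.poly_zero] at h
    exact ((FaceCfg.mem_verts).1 (FaceCfg.poly_mem_verts (S := lift T e) (φ := e) (p₀ := P.p₀) (M := 1) hj0 hj)).1 h.symm
  · exfalso
    rw [FaceCfg.poly_zero] at h
    exact ((FaceCfg.mem_verts).1 (FaceCfg.poly_mem_verts (S := lift T e) (φ := e) (p₀ := P.p₀) (M := 1) hi0 hi)).1 h
  · by_contra hne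
    rcases lt_or_gt_of_ne hne with hlt | hlt
    · exact (ne_of_lt (FaceCfg.slope_poly_lt (S := lift T e) (φ := e) (p₀ := P.p₀) (M := 1) hi0 hlt hj))
        (congrArg _ h)
    · exact (ne_of_lt (FaceCfg.slope_poly_lt (S := lift T e) (φ := e) (p₀ := P.p₀) (M := 1) hj0 hlt hi))
        (congrArg _ h.symm)

/-- **Vertex injectivity modulo the period.** [folklore] -/
theorem V_inj {i j : ℕ} (h : P.V i = P.V j) : i % (P.m + 1) = j % (P.m + 1) := by
  unfold V chain at h
  have h' := sub_left_injective h
  exact P.poly_injective (Nat.lt_succ_iff.1 (Nat.mod_lt _ (Nat.succ_pos _)))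
    (Nat.lt_succ_iff.1 (Nat.mod_lt _ (Nat.succ_pos _))) h'

/-- A vertex off the side `[V_j, V_{j+1}]` has `f_j < 1`. [cite: KishimotoYoneda2022, §3 proof of Prop. 3.1 (i)(a)] -/
theorem fE_lt_one_of_V {i j : ℕ} (h1 : P.V i ≠ P.V j) (h2 : P.V i ≠ P.V (j + 1)) : P.fE j (P.V i) < 1 := by
  rcases (P.fE_le_one j (P.V_mem i)).lt_or_eq with hlt | heq
  · exact hlt
  · exfalso
    obtain ⟨θ, hθ0, hθ1, hθ⟩ := P.fE_eq_one j (P.V_mem i) heq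
    rcases hθ0.lt_or_eq with hθ0' | hθ0'
    · rcases hθ1.lt_or_eq with hθ1' | hθ1'
      · -- `V_i` is in the open segment: contradiction with extremality (lifted)
        obtain ⟨i', hi', ei, -⟩ := chain_consecutive (S := lift T e) (φ := e) (p₀ := P.p₀) i
        obtain ⟨j', hj', ej, ej1⟩ := chain_consecutive (S := lift T e) (φ := e) (p₀ := P.p₀) j
        have hext := (P.faceCfg.poly_mem_face' (Nat.le_succ_of_le hi')).2
        have hFj := (P.faceCfg.poly_mem_face' (Nat.le_succ_of_le hj')).1
        have hFj1 := (P.faceCfg.poly_mem_face' (Nat.succ_le_succ hj')).1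
        rw [← ei] at hext
        rw [← ej] at hFj
        rw [← ej1] at hFj1
        have hseg : chain (lift T e) e P.p₀ i ∈ openSegment ℝ (chain (lift T e) e P.p₀ j)
            (chain (lift T e) e P.p₀ (j + 1)) := by
          refine ⟨1 - θ, θ, by linarith, hθ0', by ring, ?_⟩
          rw [← P.V_add_lift, ← P.V_add_lift, ← P.V_add_lift, hθ]
          ext k; simp; ring
        have := (FaceCfg.eq_of_extreme_of_mem_openSegment hext hFj hFj1 hseg).1
        apply h1
        have h' := congrArg (fun x => x - hc e • e) this
        simpa [V] using h'.symm
      · apply h2; rw [hθ, hθ1', one_smul, add_sub_cancel]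
    · apply h1; rw [hθ, ← hθ0', zero_smul, add_zero]

/-- The vertex-exposing functional `g_j = (f_{j-1} + f_j)/2` (`f_{j-1} = f_{j+m}`).
[cite: KishimotoYoneda2022, §3 proof of Lemma 3.3 ("a linear functional `g` on `P` satisfying `g(n₀) = 1` and `g < 1` on `S^{conv}_∥ ∖ {n₀}`")] -/
def gV (P : PolyCfg T e) (j : ℕ) (x : Fin 3 → ℝ) : ℝ := (P.fE (j + P.m) x + P.fE j x) / 2

/-- Polygon bookkeeping: `V_pred_succ`. [folklore] -/
theorem V_pred_succ (j : ℕ) : P.V (j + P.m + 1) = P.V j := by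
  rw [add_assoc]; exact P.V_periodic j

/-- Edge-functional / gauge bookkeeping: `gV_V_self`. [folklore] -/
theorem gV_V_self (j : ℕ) : P.gV j (P.V j) = 1 := by
  unfold gV
  have h1 : P.fE (j + P.m) (P.V j) = 1 := by
    have := P.fE_V_succ (j + P.m)
    rwa [P.V_pred_succ] at this
  rw [h1, fE_V_self]; norm_num

/-- Edge-functional / gauge bookkeeping: `gV_le_one`. [folklore] -/
theorem gV_le_one (j : ℕ) {s : Fin 3 → ℝ} (hs : s ∈ T) : P.gV j s ≤ 1 := by
  unfold gV
  have h1 := P.fE_le_one (j + P.m) hs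
  have h2 := P.fE_le_one j hs
  linarith

/-- Linearity rule `gV_add`. [folklore] -/
theorem gV_add (j : ℕ) (x y : Fin 3 → ℝ) : P.gV j (x + y) = P.gV j x + P.gV j y := by
  unfold gV; rw [fE_add, fE_add]; ring

/-- Linearity rule `gV_smul`. [folklore] -/
theorem gV_smul (j : ℕ) (r : ℝ) (x : Fin 3 → ℝ) : P.gV j (r • x) = r * P.gV j x := by
  unfold gV; rw [fE_smul, fE_smul]; ring

/-- Linearity rule `gV_sub`. [folklore] -/
theorem gV_sub (j : ℕ) (x y : Fin 3 → ℝ) : P.gV j (x - y) = P.gV j x - P.gV j y := by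
  rw [sub_eq_add_neg, gV_add, show -y = (-1 : ℝ) • y by simp, gV_smul]; ring

/-- Linearity rule `gV_sum`. [folklore] -/
theorem gV_sum {ι : Type*} (j : ℕ) (s : Finset ι) (g : ι → Fin 3 → ℝ) :
    P.gV j (∑ i ∈ s, g i) = ∑ i ∈ s, P.gV j (g i) := by
  unfold gV; rw [fE_sum, fE_sum, ← Finset.sum_add_distrib, Finset.sum_div]

/-- **`g_j < 1` on `T ∖ {V_j}`.** [cite: KishimotoYoneda2022, §3 proof of Lemma 3.3] -/
theorem gV_lt_one (j : ℕ) {s : Fin 3 → ℝ} (hs : s ∈ T) (hne : s ≠ P.V j) : P.gV j s < 1 := by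
  have h1 := P.fE_le_one (j + P.m) hs
  have h2 := P.fE_le_one j hs
  unfold gV
  by_contra hge
  rw [not_lt] at hge
  have e1 : P.fE (j + P.m) s = 1 := by linarith
  have e2 : P.fE j s = 1 := by linarith
  obtain ⟨θ, hθ0, hθ1, hθ⟩ := P.fE_eq_one j hs e2
  rcases hθ0.lt_or_eq with hθpos | hθz
  · -- then `f_{j-1}(V_{j+1}) = 1`, impossible
    have hv : P.fE (j + P.m) (P.V (j + 1)) = 1 := by
      have h := e1
      rw [hθ, fE_add, fE_smul, fE_sub] at h
      have h0 : P.fE (j + P.m) (P.V j) = 1 := by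
        have := P.fE_V_succ (j + P.m); rwa [P.V_pred_succ] at this
      rw [h0] at h
      have : θ * (P.fE (j + P.m) (P.V (j + 1)) - 1) = 0 := by linarith
      have := (mul_eq_zero.1 this).resolve_left hθpos.ne'
      linarith
    have hlt : P.fE (j + P.m) (P.V (j + 1)) < 1 := by
      apply P.fE_lt_one_of_V
      · -- `V_{j+1} ≠ V_{j+m}` (indices differ by `2 ≢ 0 mod m+1`, `m ≥ 2`)
        intro h
        have := P.V_inj h
        have hm := P.two_le_m
        rw [Nat.add_mod, Nat.add_mod j] at this
        have h1' : (1 : ℕ) % (P.m + 1) = 1 := Nat.mod_eq_of_lt (by omega)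
        have hm' : P.m % (P.m + 1) = P.m := Nat.mod_eq_of_lt (by omega)
        rw [h1', hm'] at this
        -- `(j% + 1) % (m+1) = (j% + m) % (m+1)` is impossible
        have hjlt : j % (P.m + 1) < P.m + 1 := Nat.mod_lt _ (Nat.succ_pos _)
        set r := j % (P.m + 1) with hr
        by_cases hr1 : r + 1 < P.m + 1
        · rw [Nat.mod_eq_of_lt hr1] at this
          by_cases hr2 : r + P.m < P.m + 1
          · rw [Nat.mod_eq_of_lt hr2] at this; omega
          · rw [Nat.mod_eq_sub_mod (by omega), Nat.mod_eq_of_lt (by omega)] at this; omega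
        · have hr' : r = P.m := by omega
          rw [hr', Nat.mod_self, Nat.mod_eq_sub_mod (by omega), Nat.mod_eq_of_lt (by omega)] at this
          omega
      · intro h
        rw [P.V_pred_succ] at h
        exact P.V_ne_succ j h.symm
    linarith
  · apply hne; rw [hθ, ← hθz, zero_smul, add_zero]

/-- Indices `j` and `j + 2` give different vertices (`m + 1 ≥ 3`). [folklore] -/
theorem V_ne_add_two (j : ℕ) : P.V j ≠ P.V (j + 2) := by
  intro h
  have := P.V_inj h
  have hm := P.two_le_m
  rw [Nat.add_mod] at this
  have h2 : (2 : ℕ) % (P.m + 1) = 2 := Nat.mod_eq_of_lt (by omega)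
  rw [h2] at this
  set r := j % (P.m + 1) with hr
  have hrlt : r < P.m + 1 := Nat.mod_lt _ (Nat.succ_pos _)
  by_cases h3 : r + 2 < P.m + 1
  · rw [Nat.mod_eq_of_lt h3] at this; omega
  · rw [Nat.mod_eq_sub_mod (by omega), Nat.mod_eq_of_lt (by omega)] at this; omega

/-! ### The Minkowski functional on the plane -/

/-- The Minkowski functional `N = max_j f_j` of the polygon.
[cite: KishimotoYoneda2022, §3 proof of Prop. 3.1 ("the Minkowski functional of the convex polygon `S^{conv}_∥`")] -/
def Nf (P : PolyCfg T e) (x : Fin 3 → ℝ) : ℝ :=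
  (Finset.range (P.m + 1)).sup' ⟨0, by simp⟩ fun j => P.fE j x

/-- Edge-functional / gauge bookkeeping: `fE_periodic`. [folklore] -/
theorem fE_periodic (j : ℕ) (x : Fin 3 → ℝ) : P.fE (j + (P.m + 1)) x = P.fE j x := by
  unfold fE; rw [show j + (P.m + 1) + 1 = (j + 1) + (P.m + 1) by ring, P.V_periodic, P.V_periodic]

/-- Edge-functional / gauge bookkeeping: `fE_mod`. [folklore] -/
theorem fE_mod (j : ℕ) (x : Fin 3 → ℝ) : P.fE (j % (P.m + 1)) x = P.fE j x := by
  conv_rhs => rw [← Nat.mod_add_div j (P.m + 1)]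
  induction j / (P.m + 1) with
  | zero => simp
  | succ k ih => rw [Nat.mul_succ, ← add_assoc, P.fE_periodic, ih]

/-- Edge-functional / gauge bookkeeping: `fE_le_Nf`. [folklore] -/
theorem fE_le_Nf (j : ℕ) (x : Fin 3 → ℝ) : P.fE j x ≤ P.Nf x := by
  rw [← P.fE_mod]
  exact Finset.le_sup' (fun j => P.fE j x) (Finset.mem_range.2 (Nat.mod_lt _ (Nat.succ_pos _)))

/-- Edge-functional / gauge bookkeeping: `exists_fE_eq_Nf`. [folklore] -/
theorem exists_fE_eq_Nf (x : Fin 3 → ℝ) : ∃ j, j < P.m + 1 ∧ P.fE j x = P.Nf x := by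
  obtain ⟨j, hj, h⟩ := Finset.exists_mem_eq_sup' (⟨0, by simp⟩ : (Finset.range (P.m + 1)).Nonempty)
    (fun j => P.fE j x)
  exact ⟨j, Finset.mem_range.1 hj, h.symm⟩

/-- Edge-functional / gauge bookkeeping: `Nf_le_iff`. [folklore] -/
theorem Nf_le_iff {x : Fin 3 → ℝ} {r : ℝ} : P.Nf x ≤ r ↔ ∀ j, P.fE j x ≤ r := by
  constructor
  · intro h j; exact (P.fE_le_Nf j x).trans h
  · intro h; unfold Nf; rw [Finset.sup'_le_iff]; exact fun j _ => h j

/-- `N ≤ 1` on `T`. [cite: KishimotoYoneda2022, §3 ("`S^{conv}_∥ = {N ≤ 1}`")] -/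
theorem Nf_le_one {s : Fin 3 → ℝ} (hs : s ∈ T) : P.Nf s ≤ 1 := P.Nf_le_iff.2 fun j => P.fE_le_one j hs

/-- **`N ≡ f_j` on the sector `j`.** [cite: KishimotoYoneda2022, §3 ("`N ≡ f` on the sectorial region")] -/
theorem Nf_sector (j : ℕ) {s t : ℝ} (hs : 0 ≤ s) (ht : 0 ≤ t) :
    P.Nf (s • P.V j + t • P.V (j + 1)) = s + t := by
  apply le_antisymm
  · exact P.Nf_le_iff.2 fun i => P.fE_sector_le i j hs ht
  · rw [← P.fE_sector_self j s t]; exact P.fE_le_Nf j _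

/-- Subadditivity of `N`. [folklore] -/
theorem Nf_add_le (x y : Fin 3 → ℝ) : P.Nf (x + y) ≤ P.Nf x + P.Nf y :=
  P.Nf_le_iff.2 fun j => by rw [fE_add]; exact add_le_add (P.fE_le_Nf j x) (P.fE_le_Nf j y)

/-- Linearity rule `Nf_sum_le`. [folklore] -/
theorem Nf_sum_le {ι : Type*} (s : Finset ι) (g : ι → Fin 3 → ℝ) :
    P.Nf (∑ i ∈ s, g i) ≤ ∑ i ∈ s, P.Nf (g i) := by
  induction s using Finset.induction_on with
  | empty => simp [Nf_le_iff]
  | insert a s ha ih =>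
    rw [Finset.sum_insert ha, Finset.sum_insert ha]
    exact (P.Nf_add_le _ _).trans (by linarith)

/-- `N(V_j) = 1`. [folklore] -/
theorem Nf_V (j : ℕ) : P.Nf (P.V j) = 1 := by
  have := P.Nf_sector j zero_le_one le_rfl (s := 1) (t := 0)
  simpa using this

/-- `N` is positive off the origin. [folklore] -/
theorem Nf_pos {x : Fin 3 → ℝ} (hx : e ⬝ᵥ x = 0) (hx0 : x ≠ 0) : 0 < P.Nf x := by
  obtain ⟨j, -, s, t, hs, ht, hxe⟩ := P.exists_sector hx hx0
  rw [hxe, P.Nf_sector j hs.le ht]; linarith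

end PolyCfg

end KY

end Literature.Analysis.FluidPDE
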